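import Literature.NumberTheory.EllipticCurves.MurtySinhaMultiplicityProofs
import Literature.NumberTheory.EllipticCurves.MurtySinhaMultiplicityHeckeProofs
import Literature.NumberTheory.EllipticCurves.MurtySinhaMultiplicityGeometricProofs
import Mathlib.Analysis.Complex.ExponentialBounds
import HarnessLib

/-!
# Murty–Sinha's multiplicity bound from the Eichler–Selberg trace formula (assembly)

Sibling file of `Literature.NumberTheory.EllipticCurves.MurtySinhaMultiplicity`. It proves the named
fact `murtySinha2009_eigenvalue_multiplicity_weightTwo` (M. R. Murty, K. Sinha, J. Number Theory
**129** (2009) 681–714 [MurtySinha2009], eq. (1) p. 683 = Cor. 23 p. 702, weight `2`) **from the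
Eichler–Selberg trace formula**, i.e. conditionally on the tree's named fact
`Literature.NumberTheory.Automorphic.HeckeTraceFormulaGL2Level N 1 2` (Schoof–van der Vlugt
Thm. 2.2 = Murty–Sinha Thm. 10) for all levels `N`:
`murtySinha2009_eigenvalue_multiplicity_weightTwo_of_traceFormula`. This is exactly the structure
of the printed proof ("The main ingredients in the proof of Theorem 2 are the Theorem 8, the
Eichler–Selberg trace formula and certain trigonometric polynomials", p. 684), with

* Thm. 8/Thm. 22 replaced by the Chebyshev–Christoffel inequality
  `MurtySinha.card_filter_eq_le_of_chebMoments` (`MurtySinhaMultiplicityProofs`);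
* Lemma 17 and the spectral side `Σ_i X_m(a_{p,i}/√p) = p^{-m/2} Tr T_{p^m}` supplied by
  `MurtySinha.heckeT_gamma0_spectralData` (`MurtySinhaMultiplicityHeckeProofs`);
* the estimates (8)–(14) and Thm. 13/Cor. 15 for `Tr T_{p^m} - [m even] p^{-m/2}·(dim)` and for
  `dim S₂(Γ₀(N)) = ψ(N)/12 + O(N^{5/6})` supplied by `MurtySinhaMultiplicityGeometricProofs`;
* Cor. 23's choice `M = c log kN / log p` made with `c = 1/100`, and the finitely many levels below
  an (astronomical, explicit) threshold absorbed into the constant via the trivial bound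
  `mult ≤ dim`.

## Main results

* `MurtySinha.multiplicity_le_of_traceFormula` — Thm. 22 for `T_p` on `S₂(Γ₀(N))`, `p ∤ N`, every `M`:
  `dim Eig(T_p, α) ≤ 74 r/(M+1) + 58896 (M+1) p^{12M} (B(N)+1)`, `r = dim S₂(Γ₀(N))`,
  `B(N) = Σ_{c ∣ N} gcd(c, N/c)`, together with `|r - ψ(N)/12| ≤ 7361 (B(N) + 1)` (Thm. 13).
* `murtySinha2009_eigenvalue_multiplicity_weightTwo_of_traceFormula` — eq. (1):
  `(∀ N, HeckeTraceFormulaGL2Level N 1 2) → murtySinha2009_eigenvalue_multiplicity_weightTwo`.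
* `MurtySinha.multiplicity_le_of_primePowTraces`,
  `murtySinha2009_eigenvalue_multiplicity_weightTwo_of_primePowTraces` — the same two results with
  the hypothesis cut down to the instances of the trace formula the proof actually consumes
  (p. 703: Thm. 10 at `n = 1` and `n = p^m`): the identities
  `cuspidalHeckeTrace N 2 1 (p^c) = geometricSide N 1 2 (p^c)`, `c ≥ 0`, for the level `N` and the
  prime `p ∤ N` at hand.

## References

* [MurtySinha2009] Thm. 2, eq. (1) p. 683; §§7–11, Thm. 10, Thm. 13, Thm. 18, Thm. 22, Cor. 23.
* [SchoofVandervlugt1991] Thm. 2.2.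
-/

noncomputable section

open scoped MatrixGroups ModularForm ComplexConjugate

open CongruenceSubgroup

namespace Literature.NumberTheory.EllipticCurves.ModularForms

namespace MurtySinha

open Finset
open Literature.NumberTheory.Automorphic
open Literature.NumberTheory.Automorphic.HeckeTraceFormulaGL2Level

/-! ### The trace formula in weight `2`, trivial character -/

/-- The hypotheses `2 ≤ k` and `χ(-1) = (-1)^k` of `HeckeTraceFormulaGL2Level` hold for `k = 2`,
`χ = 𝟙`. [folklore] -/
theorem traceFormula_two_one {N : ℕ} [NeZero N] (hTF : HeckeTraceFormulaGL2Level N 1 2)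
    {n : ℕ} (hn : 0 < n) : cuspidalHeckeTrace N 2 1 n = geometricSide N 1 2 n := by
  refine hTF le_rfl ?_ n hn
  rw [MulChar.one_apply isUnit_one.neg, zpow_two]
  norm_num

/-! ### Theorem 22 for `T_p` on `S₂(Γ₀(N))` -/

set_option maxHeartbeats 400000 in
/-- **Murty–Sinha Thm. 22 / Thm. 13 for `S₂(Γ₀(N))`, from the trace identities at the powers of
`p` only.** Let `p ∤ N` be prime, `α ∈ ℝ` with `|α| ≤ 2√p`, `r = dim S₂(Γ₀(N))`,
`B(N) = Σ_{c ∣ N} gcd(c, N/c)`. If the Eichler–Selberg identity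
`Tr(T_{p^c} | S₂(Γ₀(N))) = A₁ + A₂ + A₃ + A₄` (`cuspidalHeckeTrace N 2 1 (p^c) = geometricSide N 1 2 (p^c)`)
holds for every `c ≥ 0` — which is all of the trace formula that the argument consumes (loc. cit.
§9 uses Thm. 10 exactly at `n = 1` and `n = p^m`) — then for every `M ≥ 0`,
`dim Eig(T_p, α) ≤ 74 r/(M+1) + 58896 (M+1) p^{12M} (B(N) + 1)` (Thm. 22 p. 702 with the crude
moment errors of `MurtySinhaMultiplicityGeometricProofs` in place of Thm. 18), and
`|r - ψ(N)/12| ≤ 7361 (B(N) + 1)` (Thm. 13 p. 693, the case `n = 1 = p^0`).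
[cite: MurtySinha2009, Thm. 22 p. 702 and Thm. 13 p. 693] -/
theorem multiplicity_le_of_primePowTraces (N : ℕ) [NeZero N] (p : ℕ) [NeZero p] (hp : p.Prime)
    (hpN : ¬ p ∣ N)
    (hTF : ∀ c : ℕ, cuspidalHeckeTrace N 2 1 (p ^ c) = geometricSide N 1 2 (p ^ c))
    (α : ℝ) (hα : |α| ≤ 2 * Real.sqrt p) (M : ℕ) :
    (Module.finrank ℂ (Module.End.eigenspace (heckeT (Gamma0 N) 2 p) (α : ℂ)) : ℝ) ≤
        74 * (Module.finrank ℂ (CuspForm (Gamma0 N) 2) : ℝ) / (M + 1) +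
          58896 * (M + 1) * (p : ℝ) ^ (12 * M) * (∑ c ∈ N.divisors, (Nat.gcd c (N / c) : ℝ) + 1) ∧
      abs ((Module.finrank ℂ (CuspForm (Gamma0 N) 2) : ℝ) - (dedekindPsi N : ℝ) / 12) ≤
        7361 * (∑ c ∈ N.divisors, (Nat.gcd c (N / c) : ℝ) + 1) := by
  classical
  haveI : FiniteDimensional ℂ (CuspForm (Gamma0 N) 2) := finiteDimensional_cuspForm_gamma0 N 2
  set T : Module.End ℂ (CuspForm (Gamma0 N) 2) := heckeT (Gamma0 N) 2 p with hT_def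
  set r : ℕ := Module.finrank ℂ (CuspForm (Gamma0 N) 2) with hr_def
  set B : ℝ := ∑ c ∈ N.divisors, (Nat.gcd c (N / c) : ℝ) with hB_def
  have hB : 0 ≤ B := Finset.sum_nonneg fun _ _ ↦ by positivity
  have hN0 : N ≠ 0 := NeZero.ne N
  have hp2 : (2 : ℝ) ≤ p := by exact_mod_cast hp.two_le
  have hp1 : (1 : ℝ) ≤ p := by linarith
  -- `s = √p`, `q = 1/s`
  set s : ℝ := Real.sqrt p with hs_def
  have hs0 : 0 < s := Real.sqrt_pos.mpr (by linarith)
  have hs1 : 1 < s := by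
    rw [hs_def, Real.lt_sqrt zero_le_one]
    linarith
  have hsne : s ≠ 0 := hs0.ne'
  have hss : s * s = p := Real.mul_self_sqrt (by linarith)
  have hs2 : s ^ 2 = p := by rw [sq, hss]
  set q : ℝ := s⁻¹ with hq_def
  have hq0 : 0 ≤ q := inv_nonneg.mpr hs0.le
  have hq1 : q < 1 := inv_lt_one_of_one_lt₀ hs1
  have hqle : q ≤ 1 := hq1.le
  have hqs : q * s = 1 := inv_mul_cancel₀ hs0.ne'
  -- spectral data
  obtain ⟨E, hreal, hbot, hdim, htr⟩ := heckeT_gamma0_spectralData N 2 p hp hpN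
  set d : ℂ → ℕ := fun μ ↦ Module.finrank ℂ (Module.End.eigenspace T μ) with hd_def
  set y : ℂ → ℝ := fun μ ↦ μ.re / s with hy_def
  -- the polynomials `Q_m(μ) = s^m X_m(μ.re/s)` satisfy the `T_{p^m}`-recursion on `E`
  set Q : ℕ → ℂ → ℂ := fun m μ ↦ ((s ^ m * chebX m (y μ) : ℝ) : ℂ) with hQ_def
  have hre : ∀ μ ∈ E, ((μ.re : ℝ) : ℂ) = μ := fun μ hμ ↦ Complex.conj_eq_iff_re.mp (hreal μ hμ)
  have hQ0 : ∀ μ ∈ E, Q 0 μ = 1 := fun μ _ ↦ by simp [hQ_def]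
  have hQ1 : ∀ μ ∈ E, Q 1 μ = μ := fun μ hμ ↦ by
    simp only [hQ_def, pow_one, chebX_one, hy_def]
    rw [mul_div_assoc', mul_div_cancel_left₀ _ hsne, hre μ hμ]
  have hQ2 : ∀ μ ∈ E, ∀ m : ℕ,
      Q (m + 2) μ = μ * Q (m + 1) μ - (p : ℂ) ^ ((2 : ℤ) - 1) * Q m μ := by
    intro μ hμ m
    have hz : (p : ℂ) ^ ((2 : ℤ) - 1) = p := by norm_num
    rw [hz]
    have key : s ^ (m + 2) * chebX (m + 2) (y μ) =
        μ.re * (s ^ (m + 1) * chebX (m + 1) (y μ)) - p * (s ^ m * chebX m (y μ)) := by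
      rw [chebX_add_two, ← hs2]
      simp only [hy_def]
      field_simp
      ring
    simp only [hQ_def]
    rw [key]
    push_cast
    rw [hre μ hμ]
  -- real moments `Sr c = Σ_μ d_μ X_c(y μ)` and the trace identity `Tr(T_{p^c}) = s^c Sr c`
  set Sr : ℕ → ℝ := fun c ↦ ∑ μ ∈ E, (d μ : ℝ) * chebX c (y μ) with hSr_def
  have htrace : ∀ c : ℕ, cuspidalHeckeTrace N 2 1 (p ^ c) = ((s ^ c * Sr c : ℝ) : ℂ) := by
    intro c
    rw [htr Q hQ0 hQ1 hQ2 c]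
    simp only [hSr_def, Finset.mul_sum]
    push_cast
    refine Finset.sum_congr rfl fun μ _ ↦ ?_
    simp only [hQ_def, hd_def]
    push_cast
    ring
  have hrsum : (r : ℝ) = ∑ μ ∈ E, (d μ : ℝ) := by
    have h : ((r : ℝ) : ℂ) = ((∑ μ ∈ E, (d μ : ℝ) : ℝ) : ℂ) := by
      push_cast
      exact_mod_cast hdim
    exact_mod_cast h
  have hSr0 : Sr 0 = r := by
    rw [hrsum, hSr_def]
    simp
  -- the trace formula: `s^c Sr c = A₁(p^c) + A₂ + A₃ + A₄`, with `A₁ = [c even] ψ/12`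
  have hgeo : ∀ c : ℕ, ((s ^ c * Sr c : ℝ) : ℂ) -
      (if Even c then ((dedekindPsi N : ℚ) : ℂ) / 12 else 0) =
      ellipticTerm N 1 2 (p ^ c) + hyperbolicTerm N 1 2 (p ^ c) + parabolicTerm N 1 2 (p ^ c) := by
    intro c
    rw [← htrace c, hTF c, ← identityTerm_one_two_prime_pow N p hp hpN c, geometricSide]
    ring
  -- the error `e(n) = 7360 n^6 B + n^2 B + n^2` of the three remaining terms
  have herr : ∀ c : ℕ, ‖ellipticTerm N 1 2 (p ^ c) + hyperbolicTerm N 1 2 (p ^ c) +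
      parabolicTerm N 1 2 (p ^ c)‖ ≤
      7360 * ((p : ℝ) ^ c) ^ 6 * B + ((p : ℝ) ^ c) ^ 2 * B + ((p : ℝ) ^ c) ^ 2 := by
    intro c
    have hn1 : 1 ≤ p ^ c := Nat.one_le_pow c p hp.pos
    have h1 := norm_ellipticTerm_one_two_le N (p ^ c) hn1
    have h2 := norm_hyperbolicTerm_one_two_le N (p ^ c)
    have h3 := norm_parabolicTerm_le N 1 2 (p ^ c)
    rw [← hB_def] at h1 h2
    push_cast at h1 h2 h3
    calc _ ≤ ‖ellipticTerm N 1 2 (p ^ c) + hyperbolicTerm N 1 2 (p ^ c)‖ +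
          ‖parabolicTerm N 1 2 (p ^ c)‖ := norm_add_le _ _
      _ ≤ ‖ellipticTerm N 1 2 (p ^ c)‖ + ‖hyperbolicTerm N 1 2 (p ^ c)‖ +
          ‖parabolicTerm N 1 2 (p ^ c)‖ := add_le_add (norm_add_le _ _) le_rfl
      _ ≤ _ := by linarith
  -- consequence 1 (Thm. 13): `|r - ψ/12| ≤ 7361 B + 1 ≤ 7361 (B + 1)`
  have hdimψ' : |(r : ℝ) - (dedekindPsi N : ℝ) / 12| ≤ 7361 * B + 1 := by
    have h := hgeo 0
    simp only [pow_zero, one_mul, Even.zero, if_true, hSr0] at h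
    have h' : (((r : ℝ) - (dedekindPsi N : ℝ) / 12 : ℝ) : ℂ) =
        ellipticTerm N 1 2 1 + hyperbolicTerm N 1 2 1 + parabolicTerm N 1 2 1 := by
      rw [← h]
      push_cast
      ring
    have hn := herr 0
    simp only [pow_zero, one_pow, mul_one, one_mul] at hn
    rw [← h', Complex.norm_real, Real.norm_eq_abs] at hn
    linarith
  have hdimψ : |(r : ℝ) - (dedekindPsi N : ℝ) / 12| ≤ 7361 * (B + 1) := by linarith [hdimψ']
  refine ⟨?_, hdimψ⟩
  -- consequence 2: the moment bounds `|Sr c - r γ_c| ≤ E_M` for `c ≤ 2M`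
  set γ : ℕ → ℝ := fun c ↦ if Even c then q ^ c else 0 with hγ_def
  have hγ : ∀ c, |γ c| ≤ q ^ c := fun c ↦ by
    simp only [hγ_def]
    split_ifs
    · rw [abs_of_nonneg (pow_nonneg hq0 c)]
    · rw [abs_zero]
      exact pow_nonneg hq0 c
  set EM : ℝ := 14724 * (p : ℝ) ^ (12 * M) * (B + 1) with hEM_def
  have hmom : ∀ c ≤ 2 * M, |Sr c - r * γ c| ≤ EM := by
    intro c hc
    -- `|s^c Sr c - [c even] ψ/12| ≤ e(p^c)` and `|r - ψ/12| ≤ e(1)`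
    have hA : |s ^ c * Sr c - (if Even c then (dedekindPsi N : ℝ) / 12 else 0)| ≤
        7360 * ((p : ℝ) ^ c) ^ 6 * B + ((p : ℝ) ^ c) ^ 2 * B + ((p : ℝ) ^ c) ^ 2 := by
      have h := hgeo c
      have hcast : ((s ^ c * Sr c - (if Even c then (dedekindPsi N : ℝ) / 12 else 0) : ℝ) : ℂ) =
          ((s ^ c * Sr c : ℝ) : ℂ) - (if Even c then ((dedekindPsi N : ℚ) : ℂ) / 12 else 0) := by
        split_ifs <;> push_cast <;> ring
      have hn := herr c
      rw [← h, ← hcast, Complex.norm_real, Real.norm_eq_abs] at hn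
      exact hn
    have hR : |(r : ℝ) - (dedekindPsi N : ℝ) / 12| ≤ 7361 * B + 1 := hdimψ'
    -- combine: `Sr c - r γ_c = q^c ((s^c Sr c - [even] ψ/12) - [even] (r - ψ/12))`
    have hqc : q ^ c * s ^ c = 1 := by rw [← mul_pow, hqs, one_pow]
    have hqc1 : q ^ c ≤ 1 := pow_le_one₀ hq0 hqle
    have hqc0 : 0 ≤ q ^ c := pow_nonneg hq0 c
    have hkey : Sr c - r * γ c = q ^ c * ((s ^ c * Sr c -
        (if Even c then (dedekindPsi N : ℝ) / 12 else 0)) -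
        (if Even c then ((r : ℝ) - (dedekindPsi N : ℝ) / 12) else 0)) := by
      simp only [hγ_def]
      split_ifs <;> linear_combination (-(Sr c)) * hqc
    rw [hkey, abs_mul, abs_of_nonneg hqc0]
    have hsecond : |(if Even c then ((r : ℝ) - (dedekindPsi N : ℝ) / 12) else 0)| ≤ 7361 * B + 1 := by
      split_ifs
      · exact hR
      · rw [abs_zero]; positivity
    have hpc : ((p : ℝ) ^ c) ^ 6 ≤ (p : ℝ) ^ (12 * M) := by
      rw [← pow_mul]
      exact pow_le_pow_right₀ hp1 (by omega)
    have hpc2 : ((p : ℝ) ^ c) ^ 2 ≤ (p : ℝ) ^ (12 * M) := by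
      rw [← pow_mul]
      exact pow_le_pow_right₀ hp1 (by omega)
    have hpM1 : (1 : ℝ) ≤ (p : ℝ) ^ (12 * M) := one_le_pow₀ hp1
    calc q ^ c * |(s ^ c * Sr c - (if Even c then (dedekindPsi N : ℝ) / 12 else 0)) -
          (if Even c then ((r : ℝ) - (dedekindPsi N : ℝ) / 12) else 0)|
        ≤ 1 * ((7360 * ((p : ℝ) ^ c) ^ 6 * B + ((p : ℝ) ^ c) ^ 2 * B + ((p : ℝ) ^ c) ^ 2) +
            (7361 * B + 1)) := by
          refine mul_le_mul hqc1 ((abs_sub _ _).trans (add_le_add hA hsecond)) (abs_nonneg _)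
            zero_le_one
      _ ≤ EM := by
          rw [one_mul, hEM_def]
          nlinarith [mul_le_mul_of_nonneg_right hpc hB, mul_le_mul_of_nonneg_right hpc2 hB,
            mul_le_mul_of_nonneg_right hpM1 hB, hpM1, hpc2, hB]
  -- the eigenvalue family indexed by `ι = Σ_{μ ∈ E} Fin d_μ`
  have hrsumN : r = ∑ μ ∈ E, d μ := by exact_mod_cast hrsum
  let ι : Type := (μ : E) × Fin (d μ)
  set x : ι → ℝ := fun i ↦ y i.1 with hx_def
  have hcardι : Fintype.card ι = r := by
    rw [hrsumN, Fintype.card_sigma]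
    simp only [Fintype.card_fin]
    exact Finset.sum_coe_sort E d
  have hsumι : ∀ c : ℕ, ∑ i : ι, chebX c (x i) = Sr c := by
    intro c
    show ∑ i : ι, chebX c (x i) = ∑ μ ∈ E, (d μ : ℝ) * chebX c (y μ)
    rw [← Finset.sum_coe_sort E (fun μ ↦ (d μ : ℝ) * chebX c (y μ)),
      ← Finset.univ_sigma_univ, Finset.sum_sigma]
    refine Finset.sum_congr rfl fun μ _ ↦ ?_
    simp [hx_def, Finset.sum_const, Finset.card_univ, Fintype.card_fin, nsmul_eq_mul]
  -- multiplicity of `α` versus the count `#{i : x i = α/s}`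
  have hmult : (d (α : ℂ) : ℝ) ≤ ((Finset.univ.filter fun i : ι ↦ x i = α / s).card : ℝ) := by
    by_cases hαE : (α : ℂ) ∈ E
    · have hinj : (Finset.univ : Finset (Fin (d (α : ℂ)))).card ≤
          (Finset.univ.filter fun i : ι ↦ x i = α / s).card := by
        refine Finset.card_le_card_of_injOn (fun j ↦ (⟨⟨(α : ℂ), hαE⟩, j⟩ : ι)) (fun j _ ↦ ?_) ?_
        · simp only [Finset.coe_filter, Finset.mem_univ, true_and, Set.mem_setOf_eq]
          simp [hx_def, hy_def]
        · intro j₁ _ j₂ _ h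
          dsimp only at h
          exact eq_of_heq (Sigma.mk.inj_iff.mp h).2
      rw [Finset.card_univ, Fintype.card_fin] at hinj
      exact_mod_cast hinj
    · have h0 : d (α : ℂ) = 0 := by
        simp only [hd_def]
        rw [hbot _ hαE, finrank_bot]
      rw [h0, Nat.cast_zero]
      positivity
  -- Theorem 22 (Chebyshev form)
  have hα' : |α / s| ≤ 2 := by
    rw [abs_div, abs_of_pos hs0, div_le_iff₀ hs0]
    exact hα
  have hA := card_filter_eq_le_of_chebMoments x hα' M hq0 hq1 γ hγ (E := EM) (fun c hc ↦ by
    rw [hsumι c, hcardι]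
    exact hmom c hc)
  rw [hcardι] at hA
  -- constants: `8/((1-q)(1-q²)) ≤ 74` for `q ≤ 1/√2 ≤ 3/4`
  have hq34 : q ≤ 3 / 4 := by
    rw [hq_def, inv_le_comm₀ hs0 (by norm_num)]
    -- `4/3 ≤ √2 ≤ √p`
    have h43 : (4 / 3 : ℝ) ≤ Real.sqrt 2 := by
      rw [Real.le_sqrt (by norm_num) (by norm_num)]
      norm_num
    have h34 : ((3 : ℝ) / 4)⁻¹ = 4 / 3 := by norm_num
    rw [h34]
    exact h43.trans (Real.sqrt_le_sqrt hp2)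
  have hconst : 8 / ((1 - q) * (1 - q ^ 2)) ≤ 74 := by
    have h1 : (1 : ℝ) / 4 ≤ 1 - q := by linarith
    have h2 : (7 : ℝ) / 16 ≤ 1 - q ^ 2 := by nlinarith
    have hprod : (7 : ℝ) / 64 ≤ (1 - q) * (1 - q ^ 2) := by nlinarith
    have hpos : (0 : ℝ) < (1 - q) * (1 - q ^ 2) := by linarith
    rw [div_le_iff₀ hpos]
    linarith
  have hr0 : (0 : ℝ) ≤ r := by positivity
  have hM0 : (0 : ℝ) < M + 1 := by positivity
  calc (d (α : ℂ) : ℝ) ≤ ((Finset.univ.filter fun i : ι ↦ x i = α / s).card : ℝ) := hmult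
    _ ≤ 8 / ((1 - q) * (1 - q ^ 2)) * r / (M + 1) + 4 * (M + 1) * EM := hA
    _ ≤ 74 * r / (M + 1) + 4 * (M + 1) * EM := by
        gcongr
    _ = 74 * (r : ℝ) / (M + 1) + 58896 * (M + 1) * (p : ℝ) ^ (12 * M) * (B + 1) := by
        rw [hEM_def]
        ring

/-- **Murty–Sinha Thm. 22 / Thm. 13 for `S₂(Γ₀(N))`, from the trace formula.** Let `p ∤ N` be prime,
`α ∈ ℝ` with `|α| ≤ 2√p`, `r = dim S₂(Γ₀(N))`, `B(N) = Σ_{c ∣ N} gcd(c, N/c)`. If the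
Eichler–Selberg trace formula holds at level `N` (weight `2`, trivial character), then for every
`M ≥ 0`, `dim Eig(T_p, α) ≤ 74 r/(M+1) + 58896 (M+1) p^{12M} (B(N) + 1)` (Thm. 22 p. 702 with the
crude moment errors of `MurtySinhaMultiplicityGeometricProofs` in place of Thm. 18), and
`|r - ψ(N)/12| ≤ 7361 (B(N) + 1)` (Thm. 13 p. 693, the case `n = 1`).
[cite: MurtySinha2009, Thm. 22 p. 702 and Thm. 13 p. 693] -/
theorem multiplicity_le_of_traceFormula (N : ℕ) [NeZero N] (hTF : HeckeTraceFormulaGL2Level N 1 2)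
    (p : ℕ) [NeZero p] (hp : p.Prime) (hpN : ¬ p ∣ N) (α : ℝ) (hα : |α| ≤ 2 * Real.sqrt p)
    (M : ℕ) :
    (Module.finrank ℂ (Module.End.eigenspace (heckeT (Gamma0 N) 2 p) (α : ℂ)) : ℝ) ≤
        74 * (Module.finrank ℂ (CuspForm (Gamma0 N) 2) : ℝ) / (M + 1) +
          58896 * (M + 1) * (p : ℝ) ^ (12 * M) * (∑ c ∈ N.divisors, (Nat.gcd c (N / c) : ℝ) + 1) ∧
      abs ((Module.finrank ℂ (CuspForm (Gamma0 N) 2) : ℝ) - (dedekindPsi N : ℝ) / 12) ≤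
        7361 * (∑ c ∈ N.divisors, (Nat.gcd c (N / c) : ℝ) + 1) :=
  multiplicity_le_of_primePowTraces N p hp hpN (fun c ↦ traceFormula_two_one hTF (pow_pos hp.pos c))
    α hα M

/-! ### Eq. (1): the multiplicity bound with an absolute constant -/

set_option maxHeartbeats 400000 in
/-- **Cor. 23 bookkeeping (pure real analysis).** From the Thm. 22-type bound
`m ≤ 74 r/(M+1) + 58896 (M+1) p^{12M} (B+1)` for all `M`, the Thm. 13-type bound
`|r - ψ/12| ≤ 7361 (B+1)`, `ψ ≥ N`, `B ≤ 81 N^{5/6}` and the trivial bound `m ≤ r`, one gets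
`m ≤ A · r · log p / log 2N` with an explicit absolute constant `A` (Murty–Sinha Cor. 23, p. 702:
`M = c log kN / log p`; here `c = 1/100`, `log 2N ≤ 100 (2N)^{1/100}`, `r ≥ N/24` once
`N^{1/6} ≥ 24·7361·82`, and the levels below the two explicit thresholds `(2N)^{2/75} ≥ K₁`,
`N^{1/6} ≥ K₂` are absorbed by `m ≤ r ≤ r log p / log 2`). [cite: MurtySinha2009, Cor. 23 p. 702] -/
theorem multiplicity_bookkeeping (N p r m : ℕ) (hN : N ≠ 0) (hp : 2 ≤ p) (B ψ : ℝ) (hmr : m ≤ r)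
    (hB : 0 ≤ B) (hBle : B ≤ 81 * (N : ℝ) ^ ((5 : ℝ) / 6)) (hψ : (N : ℝ) ≤ ψ)
    (hdim : abs ((r : ℝ) - ψ / 12) ≤ 7361 * (B + 1))
    (hcore : ∀ M : ℕ, (m : ℝ) ≤ 74 * (r : ℝ) / (M + 1) +
      58896 * (M + 1) * (p : ℝ) ^ (12 * M) * (B + 1)) :
    (m : ℝ) ≤ (7401 + (75 / 2 * Real.log (101 * (58896 * 82) * 4800 / Real.log 2) +
        (Real.log 2 + 6 * Real.log (24 * 7361 * 82))) / Real.log 2) * r * Real.log p /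
      Real.log (2 * N) := by
  -- the constants
  set K₀ : ℝ := 58896 * 82 with hK₀
  set K₁ : ℝ := 101 * K₀ * 4800 / Real.log 2 with hK₁
  set K₂ : ℝ := 24 * 7361 * 82 with hK₂
  have hlog2 : (0.6931471803 : ℝ) < Real.log 2 := Real.log_two_gt_d9
  have hlog2' : 0 < Real.log 2 := by linarith
  have hlog2ne : Real.log 2 ≠ 0 := hlog2'.ne'
  have hK₁pos : 1 < K₁ := by
    rw [hK₁, hK₀, lt_div_iff₀ hlog2']
    have h := Real.log_two_lt_d9
    linarith
  have hK₂pos : 1 < K₂ := by rw [hK₂]; norm_num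
  set L₀ : ℝ := 75 / 2 * Real.log K₁ + (Real.log 2 + 6 * Real.log K₂) with hL₀
  have hlogK₁ : 0 < Real.log K₁ := Real.log_pos hK₁pos
  have hlogK₂ : 0 < Real.log K₂ := Real.log_pos hK₂pos
  have hL₀pos : 0 < L₀ := by positivity
  show (m : ℝ) ≤ (7401 + L₀ / Real.log 2) * r * Real.log p / Real.log (2 * N)
  -- basic quantities
  have hNpos : (0 : ℝ) < N := Nat.cast_pos.mpr (Nat.pos_of_ne_zero hN)
  have hN1 : (1 : ℝ) ≤ N := by exact_mod_cast Nat.one_le_iff_ne_zero.mpr hN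
  have h2N1 : (1 : ℝ) ≤ 2 * N := by linarith
  have h2N0 : (0 : ℝ) < 2 * N := by linarith
  have hp2 : (2 : ℝ) ≤ p := by exact_mod_cast hp
  set L : ℝ := Real.log (2 * N) with hL_def
  set ℓ : ℝ := Real.log p with hℓ_def
  have hℓ2 : Real.log 2 ≤ ℓ := Real.log_le_log (by norm_num) hp2
  have hℓ0 : 0 < ℓ := lt_of_lt_of_le hlog2' hℓ2
  have hℓne : ℓ ≠ 0 := hℓ0.ne'
  have hL2 : Real.log 2 ≤ L := Real.log_le_log (by norm_num) (by linarith)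
  have hL0 : 0 < L := lt_of_lt_of_le hlog2' hL2
  have hLne : L ≠ 0 := hL0.ne'
  have hr0 : (0 : ℝ) ≤ r := by positivity
  have hmr' : (m : ℝ) ≤ r := by exact_mod_cast hmr
  have hgoal_of : ∀ C : ℝ, C ≤ 7401 + L₀ / Real.log 2 → (m : ℝ) ≤ C * r * ℓ / L →
      (m : ℝ) ≤ (7401 + L₀ / Real.log 2) * r * ℓ / L := by
    intro C hC h
    refine h.trans ?_
    rw [div_le_div_iff_of_pos_right hL0]
    exact mul_le_mul_of_nonneg_right (mul_le_mul_of_nonneg_right hC hr0) hℓ0.le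
  have hB1 : B + 1 ≤ 82 * (N : ℝ) ^ ((5 : ℝ) / 6) := by
    have h2 : (1 : ℝ) ≤ (N : ℝ) ^ ((5 : ℝ) / 6) := Real.one_le_rpow hN1 (by norm_num)
    linarith
  have hLle : L ≤ 100 * (2 * (N : ℝ)) ^ ((1 : ℝ) / 100) := by
    have h1 : L ≤ (2 * (N : ℝ)) ^ ((1 : ℝ) / 100) / ((1 : ℝ) / 100) :=
      Real.log_le_rpow_div h2N0.le (by norm_num)
    rw [div_div_eq_mul_div, div_one] at h1
    linarith
  -- dichotomy: good levels versus small levels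
  by_cases hgood : K₁ ≤ (2 * (N : ℝ)) ^ ((2 : ℝ) / 75) ∧ K₂ ≤ (N : ℝ) ^ ((1 : ℝ) / 6)
  · obtain ⟨hG1, hG2⟩ := hgood
    -- Theorem 22 with `M = ⌊L / (100 ℓ)⌋`
    set M : ℕ := ⌊L / (100 * ℓ)⌋₊ with hM_def
    have hMle : (M : ℝ) ≤ L / (100 * ℓ) := Nat.floor_le (by positivity)
    have hMlt : L / (100 * ℓ) < M + 1 := Nat.lt_floor_add_one _
    have hM0 : (0 : ℝ) < M + 1 := by positivity
    have hmain := hcore M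
    -- (i) main term `74 r/(M+1) ≤ 7400 r ℓ / L`
    have hi : 74 * (r : ℝ) / (M + 1) ≤ 7400 * r * ℓ / L := by
      rw [div_le_div_iff₀ hM0 hL0]
      have h : L ≤ 100 * ℓ * (M + 1) := by
        rw [div_lt_iff₀ (by positivity)] at hMlt
        linarith
      nlinarith [mul_le_mul_of_nonneg_left h (by positivity : (0 : ℝ) ≤ 74 * r)]
    -- (ii) `p^{12M} ≤ (2N)^{3/25}`
    have hii : (p : ℝ) ^ (12 * M) ≤ (2 * (N : ℝ)) ^ ((3 : ℝ) / 25) := by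
      have hp0 : (0 : ℝ) < p := by linarith
      rw [← Real.rpow_natCast, Real.rpow_def_of_pos hp0, Real.rpow_def_of_pos h2N0,
        Real.exp_le_exp, ← hℓ_def, ← hL_def]
      push_cast
      have : ℓ * (12 * (M : ℝ)) ≤ ℓ * (12 * (L / (100 * ℓ))) :=
        mul_le_mul_of_nonneg_left (mul_le_mul_of_nonneg_left hMle (by norm_num)) hℓ0.le
      refine this.trans (le_of_eq ?_)
      field_simp
      ring
    -- (iii) `M + 1 ≤ 1 + L ≤ 101 (2N)^{1/100}`
    have hiii : (M : ℝ) + 1 ≤ 101 * (2 * (N : ℝ)) ^ ((1 : ℝ) / 100) := by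
      have h100 : L / (100 * ℓ) ≤ L := by
        rw [div_le_iff₀ (by positivity)]
        have h1 : (1 : ℝ) ≤ 100 * ℓ := by linarith
        nlinarith [mul_le_mul_of_nonneg_left h1 hL0.le]
      have h2 : (1 : ℝ) ≤ (2 * (N : ℝ)) ^ ((1 : ℝ) / 100) := Real.one_le_rpow h2N1 (by norm_num)
      linarith
    -- (iv) the error term is at most `101 K₀ (2N)^{289/300}`
    have hNle : (N : ℝ) ^ ((5 : ℝ) / 6) ≤ (2 * (N : ℝ)) ^ ((5 : ℝ) / 6) :=
      Real.rpow_le_rpow (by positivity) (by linarith) (by norm_num)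
    have herr : 58896 * ((M : ℝ) + 1) * (p : ℝ) ^ (12 * M) * (B + 1) ≤
        101 * K₀ * (2 * (N : ℝ)) ^ ((289 : ℝ) / 300) := by
      have hsplit : (2 * (N : ℝ)) ^ ((289 : ℝ) / 300) =
          (2 * (N : ℝ)) ^ ((1 : ℝ) / 100) * ((2 * (N : ℝ)) ^ ((3 : ℝ) / 25) *
            (2 * (N : ℝ)) ^ ((5 : ℝ) / 6)) := by
        rw [← Real.rpow_add h2N0, ← Real.rpow_add h2N0]
        norm_num
      rw [hsplit, hK₀]
      have hpM0 : 0 ≤ (p : ℝ) ^ (12 * M) := by positivity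
      calc 58896 * ((M : ℝ) + 1) * (p : ℝ) ^ (12 * M) * (B + 1)
          ≤ 58896 * (101 * (2 * (N : ℝ)) ^ ((1 : ℝ) / 100)) * (2 * (N : ℝ)) ^ ((3 : ℝ) / 25) *
              (82 * (2 * (N : ℝ)) ^ ((5 : ℝ) / 6)) := by
            refine mul_le_mul (mul_le_mul (mul_le_mul_of_nonneg_left hiii (by norm_num))
              hii hpM0 (by positivity)) (hB1.trans ?_) (by positivity) (by positivity)
            exact mul_le_mul_of_nonneg_left hNle (by norm_num)
        _ = 101 * (58896 * 82) * ((2 * (N : ℝ)) ^ ((1 : ℝ) / 100) *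
              ((2 * (N : ℝ)) ^ ((3 : ℝ) / 25) * (2 * (N : ℝ)) ^ ((5 : ℝ) / 6))) := by ring
    -- (v) `r ≥ 2N/48` from `|r - ψ/12| ≤ 7361 (B+1)`, `ψ ≥ N`, `N^{1/6} ≥ K₂`
    have hrN : (2 * (N : ℝ)) / 48 ≤ r := by
      have h56 : 7361 * (B + 1) ≤ (N : ℝ) / 24 := by
        have hN56 : (N : ℝ) = (N : ℝ) ^ ((1 : ℝ) / 6) * (N : ℝ) ^ ((5 : ℝ) / 6) := by
          rw [← Real.rpow_add hNpos]
          norm_num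
        have h0 : 0 ≤ (N : ℝ) ^ ((5 : ℝ) / 6) := by positivity
        calc 7361 * (B + 1) ≤ 7361 * (82 * (N : ℝ) ^ ((5 : ℝ) / 6)) :=
              mul_le_mul_of_nonneg_left hB1 (by norm_num)
          _ = (K₂ * (N : ℝ) ^ ((5 : ℝ) / 6)) / 24 := by rw [hK₂]; ring
          _ ≤ ((N : ℝ) ^ ((1 : ℝ) / 6) * (N : ℝ) ^ ((5 : ℝ) / 6)) / 24 :=
              div_le_div_of_nonneg_right (mul_le_mul_of_nonneg_right hG2 h0) (by norm_num)
          _ = (N : ℝ) / 24 := by rw [← hN56]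
      have habs := abs_sub_le_iff.mp hdim
      linarith [habs.2]
    -- (vi) error ≤ r ℓ / L
    have hvii : 101 * K₀ * (2 * (N : ℝ)) ^ ((289 : ℝ) / 300) ≤ (r : ℝ) * ℓ / L := by
      have hx1 : 0 < (2 * (N : ℝ)) ^ ((1 : ℝ) / 100) := by positivity
      have hlow : (2 * (N : ℝ)) / 48 * Real.log 2 / (100 * (2 * (N : ℝ)) ^ ((1 : ℝ) / 100)) ≤
          (r : ℝ) * ℓ / L := by
        rw [div_le_div_iff₀ (by positivity) hL0]
        have := mul_le_mul (mul_le_mul hrN hℓ2 hlog2'.le hr0) hLle hL0.le (by positivity)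
        linarith [this]
      refine le_trans ?_ hlow
      rw [le_div_iff₀ (by positivity)]
      have h2N : (2 * (N : ℝ)) = (2 * (N : ℝ)) ^ ((2 : ℝ) / 75) *
          ((2 * (N : ℝ)) ^ ((289 : ℝ) / 300) * (2 * (N : ℝ)) ^ ((1 : ℝ) / 100)) := by
        rw [← Real.rpow_add h2N0, ← Real.rpow_add h2N0]
        norm_num
      have hx2 : 0 ≤ (2 * (N : ℝ)) ^ ((289 : ℝ) / 300) * (2 * (N : ℝ)) ^ ((1 : ℝ) / 100) := by
        positivity
      have hK₁' : 101 * K₀ * 4800 / Real.log 2 ≤ (2 * (N : ℝ)) ^ ((2 : ℝ) / 75) := by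
        rw [← hK₁]; exact hG1
      calc 101 * K₀ * (2 * (N : ℝ)) ^ ((289 : ℝ) / 300) * (100 * (2 * (N : ℝ)) ^ ((1 : ℝ) / 100))
          = (101 * K₀ * 4800 / Real.log 2) *
              ((2 * (N : ℝ)) ^ ((289 : ℝ) / 300) * (2 * (N : ℝ)) ^ ((1 : ℝ) / 100)) *
                (Real.log 2 / 48) := by
            field_simp
            ring
        _ ≤ (2 * (N : ℝ)) ^ ((2 : ℝ) / 75) *
              ((2 * (N : ℝ)) ^ ((289 : ℝ) / 300) * (2 * (N : ℝ)) ^ ((1 : ℝ) / 100)) *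
                (Real.log 2 / 48) :=
            mul_le_mul_of_nonneg_right (mul_le_mul_of_nonneg_right hK₁' hx2)
              (div_nonneg hlog2'.le (by norm_num))
        _ = 2 * (N : ℝ) / 48 * Real.log 2 := by rw [← h2N]; ring
    -- conclude in the good regime with constant `7401`
    refine hgoal_of 7401 (by linarith [div_nonneg hL₀pos.le hlog2'.le]) ?_
    calc (m : ℝ) ≤ 74 * (r : ℝ) / (M + 1) + 58896 * (M + 1) * (p : ℝ) ^ (12 * M) * (B + 1) := hmain
      _ ≤ 7400 * r * ℓ / L + r * ℓ / L := add_le_add hi (herr.trans hvii)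
      _ = 7401 * r * ℓ / L := by ring
  · -- small levels: `L ≤ L₀`, and `m ≤ r ≤ (L₀ / log 2) · r ℓ / L`
    have hLle₀ : L ≤ L₀ := by
      rw [not_and_or, not_le, not_le] at hgood
      rcases hgood with h1 | h2
      · -- `(2N)^{2/75} < K₁`
        have hpos : 0 < (2 * (N : ℝ)) ^ ((2 : ℝ) / 75) := by positivity
        have hlog : Real.log ((2 * (N : ℝ)) ^ ((2 : ℝ) / 75)) < Real.log K₁ :=
          Real.log_lt_log hpos h1
        rw [Real.log_rpow h2N0, ← hL_def] at hlog
        have hL' : L < 75 / 2 * Real.log K₁ := by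
          have h := mul_lt_mul_of_pos_left hlog (show (0 : ℝ) < 75 / 2 by norm_num)
          calc L = 75 / 2 * (2 / 75 * L) := by ring
            _ < 75 / 2 * Real.log K₁ := h
        rw [hL₀]
        exact (hL'.trans_le (le_add_of_nonneg_right
          (add_nonneg hlog2'.le (mul_nonneg (by norm_num) hlogK₂.le)))).le
      · -- `N^{1/6} < K₂`
        have hpos : 0 < (N : ℝ) ^ ((1 : ℝ) / 6) := by positivity
        have hlog : Real.log ((N : ℝ) ^ ((1 : ℝ) / 6)) < Real.log K₂ := Real.log_lt_log hpos h2
        rw [Real.log_rpow hNpos] at hlog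
        have hLN : L = Real.log 2 + Real.log N := by
          rw [hL_def, Real.log_mul (by norm_num) (Nat.cast_ne_zero.mpr hN)]
        have hN' : Real.log N < 6 * Real.log K₂ := by
          have h := mul_lt_mul_of_pos_left hlog (show (0 : ℝ) < 6 by norm_num)
          calc Real.log N = 6 * (1 / 6 * Real.log N) := by ring
            _ < 6 * Real.log K₂ := h
        rw [hL₀, hLN]
        calc Real.log 2 + Real.log N ≤ Real.log 2 + 6 * Real.log K₂ := by
              exact add_le_add le_rfl hN'.le
          _ ≤ 75 / 2 * Real.log K₁ + (Real.log 2 + 6 * Real.log K₂) :=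
              le_add_of_nonneg_left (mul_nonneg (by norm_num) hlogK₁.le)
    refine hgoal_of (L₀ / Real.log 2) (by linarith) ?_
    have hkey : (r : ℝ) ≤ L₀ / Real.log 2 * r * ℓ / L := by
      rw [le_div_iff₀ hL0]
      have h1 : (r : ℝ) * L * Real.log 2 ≤ r * L₀ * Real.log 2 :=
        mul_le_mul_of_nonneg_right (mul_le_mul_of_nonneg_left hLle₀ hr0) hlog2'.le
      have h2 : (r : ℝ) * L₀ * Real.log 2 ≤ r * L₀ * ℓ :=
        mul_le_mul_of_nonneg_left hℓ2 (by positivity)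
      have h3 : L₀ / Real.log 2 * r * ℓ = (r * L₀ * ℓ) / Real.log 2 := by ring
      rw [h3, le_div_iff₀ hlog2']
      exact h1.trans h2
    exact hmr'.trans hkey

end MurtySinha

open Literature.NumberTheory.Automorphic
  Literature.NumberTheory.Automorphic.HeckeTraceFormulaGL2Level in
/-- **Murty–Sinha 2009, eq. (1) (weight `2`), from the trace identities at prime powers.** If, for
every level `N ≥ 1` and every prime `p ∤ N`, the Eichler–Selberg identity
`Tr(T_{p^c} | S₂(Γ₀(N))) = A₁ + A₂ + A₃ + A₄` (Schoof–van der Vlugt Thm. 2.2 = Murty–Sinha Thm. 10,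
weight `2`, trivial character, `n = p^c`) holds for all `c ≥ 0` — the only instances of the trace
formula used in loc. cit. §9 — then there is an absolute constant `A` with
`dim Eig(T_p, α) ≤ A · dim S₂(Γ₀(N)) · log p / log 2N` for all `N ≥ 1`, primes `p ∤ N` and real
`|α| ≤ 2√p`, i.e. the named fact `murtySinha2009_eigenvalue_multiplicity_weightTwo`
(`multiplicity_le_of_primePowTraces` + `multiplicity_bookkeeping`, i.e. Thm. 22 + Cor. 23).
[cite: MurtySinha2009, eq. (1) p. 683 and Cor. 23 p. 702] -/
theorem murtySinha2009_eigenvalue_multiplicity_weightTwo_of_primePowTraces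
    (hTF : ∀ (N : ℕ) [NeZero N] (p : ℕ) [NeZero p], p.Prime → ¬ p ∣ N →
      ∀ c : ℕ, cuspidalHeckeTrace N 2 1 (p ^ c) = geometricSide N 1 2 (p ^ c)) :
    murtySinha2009_eigenvalue_multiplicity_weightTwo := by
  unfold murtySinha2009_eigenvalue_multiplicity_weightTwo
  refine ⟨7401 + (75 / 2 * Real.log (101 * (58896 * 82) * 4800 / Real.log 2) +
      (Real.log 2 + 6 * Real.log (24 * 7361 * 82))) / Real.log 2, ?_⟩
  intro N _ p _ hp hpN α hα
  haveI : FiniteDimensional ℂ (CuspForm (Gamma0 N) 2) := finiteDimensional_cuspForm_gamma0 N 2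
  have hN0 : N ≠ 0 := NeZero.ne N
  have hcore := fun M : ℕ ↦
    (MurtySinha.multiplicity_le_of_primePowTraces N p hp hpN (hTF N p hp hpN) α hα M).1
  have hdim := (MurtySinha.multiplicity_le_of_primePowTraces N p hp hpN (hTF N p hp hpN) α hα 0).2
  have hBle := MurtySinha.sum_divisors_gcd_le_rpow N hN0
  have hmr := Submodule.finrank_le (Module.End.eigenspace (heckeT (Gamma0 N) 2 p) (α : ℂ))
  have hψ : (N : ℝ) ≤ (dedekindPsi N : ℝ) := by exact_mod_cast MurtySinha.le_dedekindPsi N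
  have hB : (0 : ℝ) ≤ ∑ c ∈ N.divisors, (Nat.gcd c (N / c) : ℝ) :=
    Finset.sum_nonneg fun _ _ ↦ by positivity
  exact MurtySinha.multiplicity_bookkeeping N p _ _ hN0 hp.two_le _ _ hmr hB hBle hψ hdim hcore

open Literature.NumberTheory.Automorphic
  Literature.NumberTheory.Automorphic.HeckeTraceFormulaGL2Level in
/-- **Murty–Sinha 2009, eq. (1) (weight `2`), from the Eichler–Selberg trace formula.** If the
trace formula `HeckeTraceFormulaGL2Level N 1 2` (Schoof–van der Vlugt Thm. 2.2 = Murty–Sinha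
Thm. 10, weight `2`, trivial character) holds at every level `N`, then there is an absolute constant
`A` with `dim Eig(T_p, α) ≤ A · dim S₂(Γ₀(N)) · log p / log 2N` for all `N ≥ 1`, primes `p ∤ N`
and real `|α| ≤ 2√p` — the named fact `murtySinha2009_eigenvalue_multiplicity_weightTwo`
(`multiplicity_le_of_traceFormula` + `multiplicity_bookkeeping`, i.e. Thm. 22 + Cor. 23).
[cite: MurtySinha2009, eq. (1) p. 683 and Cor. 23 p. 702] -/
theorem murtySinha2009_eigenvalue_multiplicity_weightTwo_of_traceFormula
    (hTF : ∀ (N : ℕ) [NeZero N], HeckeTraceFormulaGL2Level N 1 2) :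
    murtySinha2009_eigenvalue_multiplicity_weightTwo :=
  murtySinha2009_eigenvalue_multiplicity_weightTwo_of_primePowTraces fun N _ _ _ hp _ c ↦
    MurtySinha.traceFormula_two_one (hTF N) (pow_pos hp.pos c)

end Literature.NumberTheory.EllipticCurves.ModularForms
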